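import Literature.NumberTheory.Automorphic.ArchLocalDiagonalSignFrame       -- ★ p843467 (A-p18 g25): the SAME-sign frame and the generic transport lemmas (`…_of_signs`)
import Literature.NumberTheory.Automorphic.ArchLocalStableConjDefinite      -- ★ `unitaryGroupOfForm_neg`: `U(σ, −H) = U(σ, H)`
import HarnessLib

/-!
# Two diagonal frames WITH OPPOSITE SIGN PATTERNS are isomorphic by a real positive diagonal matrix commuting with the torus: `U(σ_{w₀} diag α₀)(ℂ) ≃ₜ* U(σ_w diag α)(ℂ)`
# when `re σ_wα_i · re σ_{w₀}α₀_i < 0` for all `i` — because `U(−H) = U(H)` (Platonov–Rapinchuk 1994 §2.3; Rogawski 1990 §8.4 p. 126)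

Topic `NumberTheory/Automorphic`; namespace `Literature.NumberTheory.Automorphic.UnitaryGroup`.  THEOREMS ONLY (no `def` — the equivalence is ★ `ContinuousMulEquiv.restrictSubgroup` of
★ `GLn.conjEquiv`; no instance, no notation, no axiom, no named fact, no `sorry`).  Cell `pub/hodgecm-mathlib`, ENGINE T1 (crux H413 = `stmt-HodgeConjecture-24833`); ROAD A toward N1 =
the registered stub `stub_L21`; brick (G′-a), the OPPOSITE-sign twin of ★ `ArchLocalDiagonalSignFrame` (brick (G), same author lineage): the closer's reduction ★
`archCentralLimitFormulaRankTwo_of_compactPair01` asks the letter at the CM sign patterns `(+,+,−)` AND `(−,−,+)`, while the D-chamber value `hDmin ⟸ cornerValue_min_of_ball` (F0P3a-p02) is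
typed at `(+,+,−)`; this frame carries `(−,−,+)` to `(+,+,−)` (sequel `Rogawski1990/ArchCentralLimitFormulaOfOppositeSigns`).  Author A-p18 (g26), 2026-09-01.

THE FRAME.  For `a = re σ_w(α)`, `a₀ = re σ_{w₀}(α₀)` with `a_i a₀_i < 0` (opposite signs), `T = diag(√(−a₀_i ∕ a_i))` is real positive diagonal with `Tᴴ·diag(a)·T = −diag(a₀)`, and `T`
commutes with every `diag z`.  Since `U(σ, −H₀) = U(σ, H₀)` (★ `unitaryGroupOfForm_neg`), `u ↦ T u T⁻¹` is still a topological-group isomorphism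
`e : U(σ_{w₀} diag α₀)(ℂ) ≃ₜ* U(σ_w diag α)(ℂ)` fixing the torus pointwise — exactly the frame data `⟨T, e, he, hez, hTz⟩` that the transport lemmas of ★ `ArchLocalDiagonalSignFrame` §3–§5
(`integral_comp_conj_eq_integral_map_symm_of_signs`, `isHaarMeasure_map_symm_of_signs`, `isMulRightInvariant_map_symm_of_signs`, `hasCompactSupport_comp_conj_of_signs`,
`comp_conj_circleDiagonal_of_signs`) consume (they never used the sign hypothesis).
HONEST LABEL: frame bookkeeping; proves nothing about HC_CM, which is proved only modulo the printed citations until rung 0 closes.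

## References
* [PlatonovRapinchuk1994] V. Platonov, A. Rapinchuk, *Algebraic Groups and Number Theory* (1994), §2.3.
* [Rogawski1990] J. D. Rogawski, *Automorphic Representations of Unitary Groups in Three Variables*, Ann. of Math. Stud. 123 (1990), §8.4 pp. 126–127.
-/

set_option autoImplicit false

noncomputable section

open MeasureTheory Measure NumberField NumberField.InfinitePlace Topology Matrix

namespace Literature.NumberTheory.Automorphic.UnitaryGroup

section OppositeSignFrame

variable (L : Type) [Field L] (α : Fin 3 → L) (w : {w : InfinitePlace L // IsComplex w})
variable (L₀ : Type) [Field L₀] (α₀ : Fin 3 → L₀) (w₀ : {w : InfinitePlace L₀ // IsComplex w})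

/-- **THE OPPOSITE-SIGN FRAME.**  If `σ_wα_i` and `σ_{w₀}α₀_i` are real with opposite signs, `T = diag(√(−re σ_{w₀}α₀_i ∕ re σ_wα_i))` satisfies `Tᴴ·σ_w(diag α)·T = −σ_{w₀}(diag α₀)` and
commutes with the torus. [cite: PlatonovRapinchuk1994, §2.3] [cite: Rogawski1990, §8.4 p. 126] -/
theorem exists_oppositeSignFrame_formCongr_eq_neg (hreal : ∀ i, (w.1.embedding (α i)).im = 0) (hreal₀ : ∀ i, (w₀.1.embedding (α₀ i)).im = 0)
    (hopp : ∀ i, (w.1.embedding (α i)).re * (w₀.1.embedding (α₀ i)).re < 0) :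
    ∃ T : GL (Fin 3) ℂ, ((T : Matrix (Fin 3) (Fin 3) ℂ) = Matrix.diagonal fun i => ((Real.sqrt (-(w₀.1.embedding (α₀ i)).re / (w.1.embedding (α i)).re) : ℝ) : ℂ)) ∧
      formCongr (starRingEnd ℂ) T ((Matrix.diagonal α).map w.1.embedding) = -((Matrix.diagonal α₀).map w₀.1.embedding) ∧
      ∀ z : Fin 3 → Circle, T⁻¹ * circleDiagonal 3 z * T = circleDiagonal 3 z := by
  have hq : ∀ i, 0 < -(w₀.1.embedding (α₀ i)).re / (w.1.embedding (α i)).re := by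
    intro i
    have h := hopp i
    rcases lt_or_gt_of_ne (show (w.1.embedding (α i)).re ≠ 0 from fun h0 => by rw [h0, zero_mul] at h; exact lt_irrefl _ h) with ha | ha
    · exact div_pos_of_neg_of_neg (by nlinarith) ha
    · exact div_pos (by nlinarith) ha
  have hr : ∀ i, Real.sqrt (-(w₀.1.embedding (α₀ i)).re / (w.1.embedding (α i)).re) ≠ 0 := fun i => (Real.sqrt_pos.2 (hq i)).ne'
  set D : Matrix (Fin 3) (Fin 3) ℂ := Matrix.diagonal fun i => ((Real.sqrt (-(w₀.1.embedding (α₀ i)).re / (w.1.embedding (α i)).re) : ℝ) : ℂ) with hD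
  have hdet : D.det ≠ 0 := by
    rw [hD, Matrix.det_diagonal]
    exact Finset.prod_ne_zero_iff.2 fun i _ => Complex.ofReal_ne_zero.2 (hr i)
  refine ⟨Matrix.GeneralLinearGroup.mkOfDetNeZero D hdet, rfl, ?_, ?_⟩
  · have hz : ∀ i, w.1.embedding (α i) = (((w.1.embedding (α i)).re : ℝ) : ℂ) := fun i =>
      (Complex.conj_eq_iff_re.1 (Complex.conj_eq_iff_im.2 (hreal i))).symm
    have hz₀ : ∀ i, w₀.1.embedding (α₀ i) = (((w₀.1.embedding (α₀ i)).re : ℝ) : ℂ) := fun i =>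
      (Complex.conj_eq_iff_re.1 (Complex.conj_eq_iff_im.2 (hreal₀ i))).symm
    have hH : (Matrix.diagonal α).map w.1.embedding = Matrix.diagonal fun i => (((w.1.embedding (α i)).re : ℝ) : ℂ) := by
      rw [Matrix.diagonal_map (map_zero _)]; congr 1; funext i; exact hz i
    have hH₀ : -((Matrix.diagonal α₀).map w₀.1.embedding) = Matrix.diagonal fun i => ((-(w₀.1.embedding (α₀ i)).re : ℝ) : ℂ) := by
      rw [Matrix.diagonal_map (map_zero _), Matrix.diagonal_neg]; congr 1; funext i; rw [hz₀ i]; simp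
    show ((D.map (starRingEnd ℂ))ᵀ * ((Matrix.diagonal α).map w.1.embedding) * D) = -((Matrix.diagonal α₀).map w₀.1.embedding)
    have hDmap : D.map (starRingEnd ℂ) = D := by
      rw [hD, Matrix.diagonal_map (map_zero _)]; congr 1; funext i; exact Complex.conj_ofReal _
    rw [hDmap, hD, Matrix.diagonal_transpose, hH, hH₀, Matrix.diagonal_mul_diagonal, Matrix.diagonal_mul_diagonal]
    congr 1
    funext i
    have hsq : Real.sqrt (-(w₀.1.embedding (α₀ i)).re / (w.1.embedding (α i)).re) ^ 2 = -(w₀.1.embedding (α₀ i)).re / (w.1.embedding (α i)).re :=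
      Real.sq_sqrt (hq i).le
    have ha : (w.1.embedding (α i)).re ≠ 0 := fun h => by have := hopp i; rw [h, zero_mul] at this; exact lt_irrefl _ this
    have e1 : Real.sqrt (-(w₀.1.embedding (α₀ i)).re / (w.1.embedding (α i)).re) * (w.1.embedding (α i)).re *
        Real.sqrt (-(w₀.1.embedding (α₀ i)).re / (w.1.embedding (α i)).re) = -(w₀.1.embedding (α₀ i)).re := by
      rw [show Real.sqrt (-(w₀.1.embedding (α₀ i)).re / (w.1.embedding (α i)).re) * (w.1.embedding (α i)).re *
          Real.sqrt (-(w₀.1.embedding (α₀ i)).re / (w.1.embedding (α i)).re) =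
          Real.sqrt (-(w₀.1.embedding (α₀ i)).re / (w.1.embedding (α i)).re) ^ 2 * (w.1.embedding (α i)).re by ring, hsq]
      field_simp
    have e2 := congrArg (fun x : ℝ => (x : ℂ)) e1
    push_cast at e2 ⊢
    exact e2
  · intro z
    rw [mul_assoc, inv_mul_eq_iff_eq_mul]
    apply Units.ext
    change (circleDiagonal 3 z : Matrix (Fin 3) (Fin 3) ℂ) * D = D * (circleDiagonal 3 z : Matrix (Fin 3) (Fin 3) ℂ)
    rw [coe_circleDiagonal, hD, Matrix.diagonal_mul_diagonal, Matrix.diagonal_mul_diagonal]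
    congr 1; funext i; ring

/-- **`U(σ_{w₀} diag α₀)(ℂ) ≃ₜ* U(σ_w diag α)(ℂ)` CARRYING THE TORUS TO THE TORUS** (OPPOSITE sign patterns): `∃ T e, e u = T u T⁻¹ ∧ e (t z) = t z ∧ T diag(z) T⁻¹ = diag(z)`
(★ `ContinuousMulEquiv.restrictSubgroup` of ★ `GLn.conjEquiv T`, membership by ★ `conj_mem_unitaryGroupOfForm_iff` and `U(−H₀) = U(H₀)` ★ `unitaryGroupOfForm_neg`) — the very frame data
the transport lemmas of ★ `ArchLocalDiagonalSignFrame` consume. [cite: PlatonovRapinchuk1994, §2.3] [cite: Rogawski1990, §8.4 p. 126] -/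
theorem exists_continuousMulEquiv_archLocal_of_oppositeSigns (hreal : ∀ i, (w.1.embedding (α i)).im = 0) (hreal₀ : ∀ i, (w₀.1.embedding (α₀ i)).im = 0)
    (hopp : ∀ i, (w.1.embedding (α i)).re * (w₀.1.embedding (α₀ i)).re < 0) :
    ∃ (T : GL (Fin 3) ℂ) (e : archLocal L₀ 3 (Matrix.diagonal α₀) w₀ ≃ₜ* archLocal L 3 (Matrix.diagonal α) w),
      (∀ u : archLocal L₀ 3 (Matrix.diagonal α₀) w₀, ((e u : archLocal L 3 (Matrix.diagonal α) w) : GL (Fin 3) ℂ) = T * (u : GL (Fin 3) ℂ) * T⁻¹) ∧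
      (∀ z : Fin 3 → Circle, e ⟨circleDiagonal 3 z, circleDiagonal_mem_archLocal_diagonal L₀ 3 α₀ w₀ z⟩ =
        ⟨circleDiagonal 3 z, circleDiagonal_mem_archLocal_diagonal L 3 α w z⟩) ∧
      ∀ z : Fin 3 → Circle, (T : Matrix (Fin 3) (Fin 3) ℂ) * Matrix.diagonal (fun i => (z i : ℂ)) * ((T⁻¹ : GL (Fin 3) ℂ) : Matrix (Fin 3) (Fin 3) ℂ) =
        Matrix.diagonal (fun i => (z i : ℂ)) := by
  obtain ⟨T, -, hT, hTz⟩ := exists_oppositeSignFrame_formCongr_eq_neg L α w L₀ α₀ w₀ hreal hreal₀ hopp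
  have hTz' : ∀ z : Fin 3 → Circle, T * circleDiagonal 3 z * T⁻¹ = circleDiagonal 3 z := by
    intro z
    have h := hTz z
    rw [mul_assoc, inv_mul_eq_iff_eq_mul] at h
    rw [mul_inv_eq_iff_eq_mul]
    exact h.symm
  -- membership: `T u T⁻¹ ∈ U(H) ↔ u ∈ U(Tᴴ H T) = U(−H₀) = U(H₀)`
  have hmem : ∀ u : GL (Fin 3) ℂ, u ∈ archLocal L₀ 3 (Matrix.diagonal α₀) w₀ ↔ GLn.conjEquiv T u ∈ archLocal L 3 (Matrix.diagonal α) w := fun u => by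
    have h := conj_mem_unitaryGroupOfForm_iff (starRingEnd ℂ) T ((Matrix.diagonal α).map w.1.embedding) u
    rw [hT, unitaryGroupOfForm_neg] at h
    exact h.symm
  refine ⟨T, ContinuousMulEquiv.restrictSubgroup (GLn.conjEquiv T) _ _ hmem, fun u => rfl, fun z => ?_, fun z => ?_⟩
  · apply Subtype.ext
    show T * circleDiagonal 3 z * T⁻¹ = circleDiagonal 3 z
    exact hTz' z
  · have h := congrArg (fun g : GL (Fin 3) ℂ => (g : Matrix (Fin 3) (Fin 3) ℂ)) (hTz' z)
    simpa only [Units.val_mul, coe_circleDiagonal] using h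

/-- With opposite signs, `α₀_i ≠ 0`. [cite: Rogawski1990, §8.4 p. 126] -/
theorem ne_zero_of_oppositeSigns (hopp : ∀ i, (w.1.embedding (α i)).re * (w₀.1.embedding (α₀ i)).re < 0) (i : Fin 3) : α₀ i ≠ 0 := by
  intro h
  have := hopp i
  rw [h, map_zero, Complex.zero_re, mul_zero] at this
  exact lt_irrefl _ this

/-- With opposite signs, indefiniteness transfers: a pair of opposite sign in `re σ_wα` is a pair of opposite sign in `re σ_{w₀}α₀`. [cite: Rogawski1990, §8.4 p. 126] -/
theorem exists_mul_re_neg_of_oppositeSigns (hopp : ∀ i, (w.1.embedding (α i)).re * (w₀.1.embedding (α₀ i)).re < 0)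
    (hind : ∃ i j : Fin 3, (w.1.embedding (α i)).re * (w.1.embedding (α j)).re < 0) :
    ∃ i j : Fin 3, (w₀.1.embedding (α₀ i)).re * (w₀.1.embedding (α₀ j)).re < 0 := by
  obtain ⟨i, j, h⟩ := hind
  refine ⟨i, j, ?_⟩
  nlinarith [mul_pos_of_neg_of_neg (hopp i) (hopp j), h, hopp i, hopp j]

end OppositeSignFrame

end Literature.NumberTheory.Automorphic.UnitaryGroup

end
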